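import Summits.AtomisticToContinuum.Crystallization.Theorems.HullExactificationCascadeZeroDefectDensityCapAtomsPattern
import HarnessLib

/-!
# Pins for the birth line of `ZeroDefectDensity` — I: the `√2`, `√3`, `√(8/3)` pairs of the two pattern graphs
# (route `HullExactificationCascade`, crux `ZeroDefectDensity`, stmt-AtomisticToContinuum-12086; stub `stub_pins`)

Support file (lead c4, stub-worker) for the registered stub `stub_pins` of
`Cruxes/ZeroDefectDensity/Lines/birth.lean`: the square diagonals (`√2` pairs), the `√3` pairs and
(hcp) the `√(8/3)` pairs of a softly twelve-kissed shell whose soft contact graph is the fcc or the hcp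
pattern graph are metrically pinned.  The stub glues PATTERN COMBINATORICS to three metric lemmas it
receives as hypotheses (caps on induced soft 4-cycles, the squared octahedron lemma, the quantitative
link lemma); this file supplies the combinatorics, on the integer models `fccTab` (scale `N = 2`) and
`hcpTab` (scale `N = 18`) of `Literature/Geometry/DiscreteGeometry/KissingRigidity.lean`, where
`dist² = |tab i - tab j|² / N`, so that `dist = 1, √2, √3, √(8/3)` read `|tab i - tab j|² = N, 2N, 3N, 8N/3`:

* `chart_sq`, `fcc_chart_full`, `hcp_chart_full` — the enumeration `i ↦ tab i / √N` as a bijection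
  `Fin 12 ≃ pattern` transporting `dist = 1` to `fccAdj`/`hcpAdj` AND `dist = √2, √3, √(8/3)` to the
  integer conditions (`fcc`: `4`, `6`, never; `hcp`: `36`, `54`, `48`).
* `fcc_sq2_square`, `hcp_sq2_square` — every `√2` pair is the diagonal of an induced 4-cycle;
  `fcc_sq2_common`, `hcp_sq2_common` — two common neighbours of a `√2` pair are never adjacent (so a cap
  of the 4-cycle is not a first-shell point).
* `fcc_sq3_link`, `hcp_sq3_link` — every `√3` pair is the far pair `(n₁,n₃)` of a type-A link
  (`c ~ nᵢ`, `n₁ ~ n₂`, `n₃ ~ n₄`, `(n₂,n₃)`, `(n₄,n₁)` square pairs) at a common neighbour `c`, or (hcp,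
  hexagonal common neighbour) the pair `(n₂,n₄)` of a type-B link (`n₁ ~ n₂ ~ n₃`, `(n₃,n₄)`, `(n₄,n₁)`
  square pairs), in one of the two orientations.
* `hcp_sq83_link` — every `√(8/3)` pair of hcp is the pair `(n₁,n₃)` of a type-B link.

All pattern facts were brute-forced over the integer tables before being `decide`d.  No new
definitions. [folklore]
-/

namespace Summit.AtomisticToContinuum.Crystallization.Theorems.ZeroDefectDensityBirth

open Literature.Geometry.DiscreteGeometry

/-! ## Scaled integer patterns: all distances are integer arithmetic -/

/-- `dist (s/√N) (t/√N)² · N = |s - t|²` for integer vectors. [folklore] -/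
theorem dist_smul_intVec_sq_mul (N : ℕ) (hN : N ≠ 0) (s t : Fin 3 → ℤ) :
    dist ((Real.sqrt N)⁻¹ • intVec s) ((Real.sqrt N)⁻¹ • intVec t) ^ 2 * N = (sqNormInt (s - t) : ℝ) := by
  have h0 : (0 : ℝ) ≤ sqNormInt (s - t) := by
    have : (0 : ℤ) ≤ sqNormInt (s - t) := by unfold sqNormInt; positivity
    exact_mod_cast this
  have hNpos : (0 : ℝ) < N := by exact_mod_cast Nat.pos_of_ne_zero hN
  rw [dist_eq_norm, ← smul_sub, intVec_sub, norm_smul, norm_inv,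
    Real.norm_of_nonneg (Real.sqrt_nonneg _), norm_intVec, mul_pow, inv_pow,
    Real.sq_sqrt hNpos.le, Real.sq_sqrt h0]
  field_simp

/-- **Charts with squared distances.** A twelve-element integer model `T = image tab` scaled by
`1/√N` is enumerated by `tab`: a bijection `Fin 12 ≃ scaledPattern T N` with
`dist (f i) (f j)² · N = |tab i - tab j|²`. [folklore] -/
theorem chart_sq {N : ℕ} (hN : N ≠ 0) {T : Finset (Fin 3 → ℤ)} {tab : Fin 12 → Fin 3 → ℤ}
    (hT : T = Finset.univ.image tab) (htab : Function.Injective tab) :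
    ∃ f : Fin 12 ≃ {q : EuclideanSpace ℝ (Fin 3) // q ∈ scaledPattern T N},
      ∀ i j : Fin 12, dist (f i).1 (f j).1 ^ 2 * N = (sqNormInt (tab i - tab j) : ℝ) := by
  -- adapted from `fcc_chart` of `…CapAtomsPattern`
  have hmem : ∀ i : Fin 12, (Real.sqrt (N : ℝ))⁻¹ • intVec (tab i) ∈ scaledPattern T N := by
    intro i
    rw [scaledPattern, hT, Finset.image_image]
    exact Finset.mem_image.2 ⟨i, Finset.mem_univ _, rfl⟩
  let g : Fin 12 → {q : EuclideanSpace ℝ (Fin 3) // q ∈ scaledPattern T N} :=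
    fun i => ⟨(Real.sqrt (N : ℝ))⁻¹ • intVec (tab i), hmem i⟩
  have hinj : Function.Injective g := fun i j h =>
    htab (scaledPattern_map_injective hN (congrArg Subtype.val h))
  have hsurj : Function.Surjective g := by
    rintro ⟨q, hq⟩
    rw [scaledPattern, hT, Finset.image_image] at hq
    obtain ⟨i, -, rfl⟩ := Finset.mem_image.1 hq
    exact ⟨i, rfl⟩
  exact ⟨Equiv.ofBijective g ⟨hinj, hsurj⟩, fun i j => dist_smul_intVec_sq_mul N hN _ _⟩

/-- Reading `dist = 1` from `dist² · N = n`. [folklore] -/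
theorem chart_conv_one {d : ℝ} {N : ℕ} {n : ℤ} (hd : 0 ≤ d) (hN : (N : ℝ) ≠ 0)
    (h : d ^ 2 * N = n) : d = 1 ↔ n = N := by
  constructor
  · rintro rfl
    have : (n : ℝ) = N := by rw [← h]; ring
    exact_mod_cast this
  · intro hn
    rw [hn, Int.cast_natCast] at h
    have h2 : d ^ 2 = 1 := mul_right_cancel₀ hN (h.trans (one_mul _).symm)
    exact (pow_eq_one_iff_of_nonneg hd two_ne_zero).1 h2

/-- Reading `dist = √a` from `dist² · N = n`. [folklore] -/
theorem chart_conv_sqrt {d a : ℝ} {N : ℕ} {n : ℤ} (ha : 0 ≤ a) (h : d ^ 2 * N = n)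
    (hd : d = Real.sqrt a) : a * N = n := by
  rw [hd, Real.sq_sqrt ha] at h
  exact h

/-- **The fcc chart, with all pattern distances.** `fccTab` enumerates `fccKissingPattern`
bijectively; `dist = 1` is `fccAdj`, `dist = √2` / `√3` force `|tab i - tab j|² = 4` / `6`, and
`dist = √(8/3)` never happens (`16/3 ∉ ℤ`). [folklore] -/
theorem fcc_chart_full :
    ∃ f : Fin 12 ≃ {q : EuclideanSpace ℝ (Fin 3) // q ∈ fccKissingPattern},
      (∀ i j : Fin 12, (dist (f i).1 (f j).1 = 1 ↔ fccAdj i j)) ∧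
      (∀ i j : Fin 12, dist (f i).1 (f j).1 = Real.sqrt 2 → sqNormInt (fccTab i - fccTab j) = 4) ∧
      (∀ i j : Fin 12, dist (f i).1 (f j).1 = Real.sqrt 3 → sqNormInt (fccTab i - fccTab j) = 6) ∧
      (∀ i j : Fin 12, dist (f i).1 (f j).1 ≠ Real.sqrt (8 / 3)) := by
  obtain ⟨f, hf⟩ := chart_sq (N := 2) two_ne_zero fccInt_eq_image fccTab_injective
  refine ⟨f, fun i j => chart_conv_one dist_nonneg (by norm_num) (hf i j), fun i j h => ?_,
    fun i j h => ?_, fun i j h => ?_⟩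
  · have h' := chart_conv_sqrt (by norm_num) (hf i j) h
    have : (sqNormInt (fccTab i - fccTab j) : ℝ) = 4 := by rw [← h']; norm_num
    exact_mod_cast this
  · have h' := chart_conv_sqrt (by norm_num) (hf i j) h
    have : (sqNormInt (fccTab i - fccTab j) : ℝ) = 6 := by rw [← h']; norm_num
    exact_mod_cast this
  · have h' := chart_conv_sqrt (by norm_num) (hf i j) h
    have h3 : ((3 * sqNormInt (fccTab i - fccTab j) : ℤ) : ℝ) = 16 := by
      push_cast; rw [← h']; norm_num
    have h4 : 3 * sqNormInt (fccTab i - fccTab j) = 16 := by exact_mod_cast h3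
    omega

/-- **The hcp chart, with all pattern distances.** `hcpTab` enumerates `hcpKissingPattern`
bijectively; `dist = 1` is `hcpAdj`, and `dist = √2` / `√3` / `√(8/3)` force
`|tab i - tab j|² = 36` / `54` / `48`. [folklore] -/
theorem hcp_chart_full :
    ∃ f : Fin 12 ≃ {q : EuclideanSpace ℝ (Fin 3) // q ∈ hcpKissingPattern},
      (∀ i j : Fin 12, (dist (f i).1 (f j).1 = 1 ↔ hcpAdj i j)) ∧
      (∀ i j : Fin 12, dist (f i).1 (f j).1 = Real.sqrt 2 → sqNormInt (hcpTab i - hcpTab j) = 36) ∧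
      (∀ i j : Fin 12, dist (f i).1 (f j).1 = Real.sqrt 3 → sqNormInt (hcpTab i - hcpTab j) = 54) ∧
      (∀ i j : Fin 12, dist (f i).1 (f j).1 = Real.sqrt (8 / 3) →
        sqNormInt (hcpTab i - hcpTab j) = 48) := by
  obtain ⟨f, hf⟩ := chart_sq (N := 18) (by norm_num) hcpInt_eq_image hcpTab_injective
  refine ⟨f, fun i j => chart_conv_one dist_nonneg (by norm_num) (hf i j), fun i j h => ?_,
    fun i j h => ?_, fun i j h => ?_⟩
  · have h' := chart_conv_sqrt (by norm_num) (hf i j) h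
    have : (sqNormInt (hcpTab i - hcpTab j) : ℝ) = 36 := by rw [← h']; norm_num
    exact_mod_cast this
  · have h' := chart_conv_sqrt (by norm_num) (hf i j) h
    have : (sqNormInt (hcpTab i - hcpTab j) : ℝ) = 54 := by rw [← h']; norm_num
    exact_mod_cast this
  · have h' := chart_conv_sqrt (by norm_num) (hf i j) h
    have : (sqNormInt (hcpTab i - hcpTab j) : ℝ) = 48 := by rw [← h']; norm_num
    exact_mod_cast this

/-! ## The fcc pattern graph: squares and links around the `√2` and `√3` pairs -/

/-- **Every `√2` pair of fcc is the diagonal of an induced 4-cycle** `i ~ k ~ j ~ l ~ i`,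
`i ≁ j`, `k ≁ l`. [folklore] -/
theorem fcc_sq2_square : ∀ i j : Fin 12, sqNormInt (fccTab i - fccTab j) = 4 →
    ∃ k l : Fin 12, fccAdj i k ∧ fccAdj k j ∧ fccAdj j l ∧ fccAdj l i ∧ ¬ fccAdj i j ∧ ¬ fccAdj k l ∧
      i ≠ j ∧ k ≠ l := by
  decide

/-- Two common neighbours of a `√2` pair of fcc are never adjacent. [folklore] -/
theorem fcc_sq2_common : ∀ i j m k : Fin 12, sqNormInt (fccTab i - fccTab j) = 4 →
    fccAdj m i → fccAdj m j → fccAdj k i → fccAdj k j → ¬ fccAdj m k := by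
  decide

-- `decide` needs a larger instance-size budget for this long decidable proposition (no heartbeat change).
set_option synthInstance.maxSize 2048 in
/-- **Every `√3` pair `(i, j)` of fcc is the far pair of a type-A link**: a common neighbour `c` and
`k, l` with `c ~ i, k, j, l`, `i ~ k`, `j ~ l`, `(k, j)` and `(l, i)` square (`√2`) pairs, `i ≁ j`,
`k ≁ l` (stated in the three-way form shared with hcp; fcc always realises the first). [folklore] -/
theorem fcc_sq3_link : ∀ i j : Fin 12, sqNormInt (fccTab i - fccTab j) = 6 → ∃ c k l : Fin 12,
    (fccAdj c i ∧ fccAdj c k ∧ fccAdj c j ∧ fccAdj c l ∧ fccAdj i k ∧ fccAdj j l ∧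
      sqNormInt (fccTab k - fccTab j) = 4 ∧ sqNormInt (fccTab l - fccTab i) = 4 ∧
      ¬ fccAdj i j ∧ i ≠ j ∧ ¬ fccAdj k l ∧ k ≠ l) ∨
    (fccAdj c k ∧ fccAdj c i ∧ fccAdj c l ∧ fccAdj c j ∧ fccAdj k i ∧ fccAdj i l ∧
      sqNormInt (fccTab l - fccTab j) = 4 ∧ sqNormInt (fccTab j - fccTab k) = 4 ∧
      ¬ fccAdj k l ∧ k ≠ l ∧ ¬ fccAdj i j ∧ i ≠ j) ∨
    (fccAdj c k ∧ fccAdj c j ∧ fccAdj c l ∧ fccAdj c i ∧ fccAdj k j ∧ fccAdj j l ∧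
      sqNormInt (fccTab l - fccTab i) = 4 ∧ sqNormInt (fccTab i - fccTab k) = 4 ∧
      ¬ fccAdj k l ∧ k ≠ l ∧ ¬ fccAdj j i ∧ j ≠ i) := by
  decide +kernel

/-! ## The hcp pattern graph: squares and links around the `√2`, `√3`, `√(8/3)` pairs -/

/-- **Every `√2` pair of hcp is the diagonal of an induced 4-cycle** `i ~ k ~ j ~ l ~ i`,
`i ≁ j`, `k ≁ l`. [folklore] -/
theorem hcp_sq2_square : ∀ i j : Fin 12, sqNormInt (hcpTab i - hcpTab j) = 36 →
    ∃ k l : Fin 12, hcpAdj i k ∧ hcpAdj k j ∧ hcpAdj j l ∧ hcpAdj l i ∧ ¬ hcpAdj i j ∧ ¬ hcpAdj k l ∧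
      i ≠ j ∧ k ≠ l := by
  decide

/-- Two common neighbours of a `√2` pair of hcp are never adjacent. [folklore] -/
theorem hcp_sq2_common : ∀ i j m k : Fin 12, sqNormInt (hcpTab i - hcpTab j) = 36 →
    hcpAdj m i → hcpAdj m j → hcpAdj k i → hcpAdj k j → ¬ hcpAdj m k := by
  decide

-- `decide` needs a larger instance-size budget for this long decidable proposition (no heartbeat change).
set_option synthInstance.maxSize 2048 in
/-- **Every `√3` pair `(i, j)` of hcp sits in a link**: either (type A, common neighbour of type
`(3,4,3,4)`) `c ~ i, k, j, l`, `i ~ k`, `j ~ l`, `(k, j)`, `(l, i)` square pairs, `i ≁ j`, `k ≁ l`; or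
(type B, hexagonal common neighbour, pair `(n₂, n₄) = (i, j)` or `(j, i)`) `c ~ k, i, l, j`,
`k ~ i ~ l`, `(l, j)`, `(j, k)` square pairs, `k ≁ l`, `i ≁ j` — resp. the same with `i, j` swapped.
[folklore] -/
theorem hcp_sq3_link : ∀ i j : Fin 12, sqNormInt (hcpTab i - hcpTab j) = 54 → ∃ c k l : Fin 12,
    (hcpAdj c i ∧ hcpAdj c k ∧ hcpAdj c j ∧ hcpAdj c l ∧ hcpAdj i k ∧ hcpAdj j l ∧
      sqNormInt (hcpTab k - hcpTab j) = 36 ∧ sqNormInt (hcpTab l - hcpTab i) = 36 ∧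
      ¬ hcpAdj i j ∧ i ≠ j ∧ ¬ hcpAdj k l ∧ k ≠ l) ∨
    (hcpAdj c k ∧ hcpAdj c i ∧ hcpAdj c l ∧ hcpAdj c j ∧ hcpAdj k i ∧ hcpAdj i l ∧
      sqNormInt (hcpTab l - hcpTab j) = 36 ∧ sqNormInt (hcpTab j - hcpTab k) = 36 ∧
      ¬ hcpAdj k l ∧ k ≠ l ∧ ¬ hcpAdj i j ∧ i ≠ j) ∨
    (hcpAdj c k ∧ hcpAdj c j ∧ hcpAdj c l ∧ hcpAdj c i ∧ hcpAdj k j ∧ hcpAdj j l ∧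
      sqNormInt (hcpTab l - hcpTab i) = 36 ∧ sqNormInt (hcpTab i - hcpTab k) = 36 ∧
      ¬ hcpAdj k l ∧ k ≠ l ∧ ¬ hcpAdj j i ∧ j ≠ i) := by
  decide +kernel

-- `decide` needs a larger instance-size budget for this long decidable proposition (no heartbeat change).
set_option synthInstance.maxSize 2048 in
/-- **Every `√(8/3)` pair `(i, j)` of hcp is the two-contact pair of a type-B link**: a common
neighbour `c` and `k, l` with `c ~ i, k, j, l`, `i ~ k ~ j`, `(j, l)`, `(l, i)` square pairs, `i ≁ j`,
`k ≁ l`. [folklore] -/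
theorem hcp_sq83_link : ∀ i j : Fin 12, sqNormInt (hcpTab i - hcpTab j) = 48 → ∃ c k l : Fin 12,
    hcpAdj c i ∧ hcpAdj c k ∧ hcpAdj c j ∧ hcpAdj c l ∧ hcpAdj i k ∧ hcpAdj k j ∧
      sqNormInt (hcpTab j - hcpTab l) = 36 ∧ sqNormInt (hcpTab l - hcpTab i) = 36 ∧
      ¬ hcpAdj i j ∧ i ≠ j ∧ ¬ hcpAdj k l ∧ k ≠ l := by
  decide +kernel

/-! ## Registered sub-goal (one line, fully qualified): every `√2` pair spans an induced 4-cycle, both patterns -/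

/-- **Registered sub-goal `pins_pattern_squares`** (helper of `stub_pins`, lead c4): in the fcc and in
the hcp pattern graph every `√2` pair is the diagonal of an induced 4-cycle
(`fcc_sq2_square ∧ hcp_sq2_square`, verbatim the registered one-line signature). [folklore] -/
theorem pins_pattern_squares : (∀ i j : Fin 12, Literature.Geometry.DiscreteGeometry.sqNormInt (Literature.Geometry.DiscreteGeometry.fccTab i - Literature.Geometry.DiscreteGeometry.fccTab j) = 4 → ∃ k l : Fin 12, Literature.Geometry.DiscreteGeometry.fccAdj i k ∧ Literature.Geometry.DiscreteGeometry.fccAdj k j ∧ Literature.Geometry.DiscreteGeometry.fccAdj j l ∧ Literature.Geometry.DiscreteGeometry.fccAdj l i ∧ ¬ Literature.Geometry.DiscreteGeometry.fccAdj i j ∧ ¬ Literature.Geometry.DiscreteGeometry.fccAdj k l ∧ i ≠ j ∧ k ≠ l) ∧ (∀ i j : Fin 12, Literature.Geometry.DiscreteGeometry.sqNormInt (Literature.Geometry.DiscreteGeometry.hcpTab i - Literature.Geometry.DiscreteGeometry.hcpTab j) = 36 → ∃ k l : Fin 12, Literature.Geometry.DiscreteGeometry.hcpAdj i k ∧ Literature.Geometry.DiscreteGeometry.hcpAdj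 k j ∧ Literature.Geometry.DiscreteGeometry.hcpAdj j l ∧ Literature.Geometry.DiscreteGeometry.hcpAdj l i ∧ ¬ Literature.Geometry.DiscreteGeometry.hcpAdj i j ∧ ¬ Literature.Geometry.DiscreteGeometry.hcpAdj k l ∧ i ≠ j ∧ k ≠ l) :=
  ⟨fcc_sq2_square, hcp_sq2_square⟩

end Summit.AtomisticToContinuum.Crystallization.Theorems.ZeroDefectDensityBirth
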